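import Literature.Probability.LatticeModels.PSStability
import HarnessLib

/-!
# Pirogov–Sinai theory, VII: the induction on the volume and the stable phase

Topic `Literature/Probability/LatticeModels`. The proof of the volume bound `(7.68)` of
Friedli–Velenik's Prop. 7.34 by induction on `|V|` in the pointwise two-phase setting of
`PSStability` — fixing the external *unstable* contours (eq. (7.86)), bounding the stable gas of the
exterior by its truncated pressure, the interiors by the induction hypothesis, and resumming the
unstable contours into the auxiliary gas `w_*` (eqs. (7.87)–(7.89)) — and its consequences:

* `volBound` : `Z_σ(V) ≤ e^{ψ̂|V| + 2|∂^in V|}` for all finite `V` with `★`-connected complement;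
* `K_le_exp_of_excess_eq_zero` : in a phase `σ` with zero excess (`a_σ = 0`; such a phase exists,
  `exists_excess_eq_zero`) every contour of type `σ` has `K_σ(γ) ≤ e^{-τ̂|γ̄|}`, `τ̂ = τ - 4^{d+2}`
  (FV (7.66) with `aⁿ_# = 0`: "all contours are stable");
* `excess_eq_zero_of_log_le` : the phase whose ground weight dominates by `2e^{-(2d+1)}` in
  logarithm has zero excess (the stability of the pure phases away from coexistence);
* `extFam_through_le` : the weight of the external families through a given contour is at most
  `K(γ₀) Z_σ(V)` (FV Lemma 7.26).

Everything is proved; no named facts.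

## References

* S. Friedli, Y. Velenik, *Statistical Mechanics of Lattice Systems*, CUP 2017, §7.3.2
  (Lemma 7.26), §7.4.3 (Prop. 7.34 and its proof, eqs. (7.77)–(7.89)). [FriedliVelenik2017]
-/

noncomputable section

open Finset Relation

namespace Literature.Probability.LatticeModels

namespace ContourModel

open ContourSetup

variable {d : ℕ} {M : ContourModel d}

/-! ### Unstable contours are large -/

/-- An unstable contour satisfies `a_σ |γ̄|^{d-1} > 1`. [cite: FriedliVelenik2017, §7.4.3 (unstable ⇒ |γ̄| ≥ (ρ₀/4a)^{d-1})] -/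
theorem one_lt_of_not_stable (hd : 1 ≤ d) {τh : ℝ} {σ : Phase} {γ : M.Γ} (h : ¬ M.Stable τh σ γ) :
    1 < M.excess τh σ * (M.size γ : ℝ) ^ (d - 1) := by
  rw [Stable, not_le] at h
  have hn : (1 : ℝ) ≤ M.size γ := by exact_mod_cast card_pos.2 (M.supp_nonempty γ)
  have hd' : (M.size γ : ℝ) ^ d = (M.size γ : ℝ) ^ (d - 1) * M.size γ := by
    rw [← pow_succ, Nat.sub_add_cancel hd]
  rw [hd', ← mul_assoc] at h
  by_contra hle
  rw [not_lt] at hle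
  have := mul_le_mul_of_nonneg_right hle (by linarith : (0 : ℝ) ≤ M.size γ)
  linarith

/-! ### The key estimate `ĝ^{st} + g_* ≤ a_σ + ĝ_σ` -/

section KeyEstimate

variable (hd : 2 ≤ d) (T : M.Shift) {τ : ℝ} (hρτ : ∀ γ, M.ρ γ ≤ Real.exp (-τ * M.size γ))
  (hρT : ∀ v γ, M.ρ (T.shift v γ) = M.ρ γ) (hKT : ∀ v γ, M.K (T.shift v γ) = M.K γ) {Kc : ℕ}
  (hKc : ∀ A, #(M.withSupp A) ≤ Kc ^ #A)
  (hτ : (Kc : ℝ) * (2 ^ (d + 1) * 9 ^ d) * Real.exp ((2 * d + 2) * 2 ^ d - (τ - 4 ^ (d + 2))) ≤ 1)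

include T hKc hτ in
/-- The zero weights merge into a small activity (trivially). [folklore] -/
theorem isSmallTIActivity_zero (σ : Phase) : IsSmallTIActivity (M.rhoHat σ fun _ => (0 : ℝ)) (2 * d + 1) :=
  isSmallTIActivity_rhoHat (τ := τ - 4 ^ (d + 2)) T (fun _ => le_rfl) (fun _ _ => Real.exp_nonneg _)
    (fun _ _ => rfl) hKc (by positivity) (by convert hτ using 3; ring)

include hd T hρτ hρT hKT hKc hτ in
/-- **The key estimate of the induction step** (FV (7.88)–(7.89) in pointwise form): writing
`τ̂ = τ - 4^{d+2}`, the truncated pressure of the stable gas and the pressure of the unstable gas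
satisfy `ĝ^{st}_σ + g_{*,σ} ≤ a_σ + ĝ_σ` (both differ from `ĝ_σ`, resp. `0`, by at most `a_σ/4`, as
the weights only differ on unstable contours, which are large).
[cite: FriedliVelenik2017, §7.4.3, eqs. (7.88)–(7.89)] -/
theorem pressure_key (σ : Phase) :
    M.pressureOf σ (M.Wst (τ - 4 ^ (d + 2)) σ) + M.pressureOf σ (M.Wstar (τ - 4 ^ (d + 2)) σ) ≤
      M.excess (τ - 4 ^ (d + 2)) σ + M.gHat (τ - 4 ^ (d + 2)) σ := by
  set τh := τ - 4 ^ (d + 2) with hτh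
  set a := M.excess τh σ with ha
  have hd1 : 1 ≤ d := by omega
  have hsK := isSmallTIActivity_Khat T hKT hKc hτ σ
  have hsW := isSmallTIActivity_Wst T hKT hKc hτ σ σ
  have hsS := isSmallTIActivity_Wstar T hρτ hρT hKc hτ σ σ
  have hs0 := isSmallTIActivity_zero T hKc hτ σ
  rcases (excess_nonneg τh σ).eq_or_lt with h0 | hpos
  · -- `a = 0`: everything is stable
    have hall : ∀ γ, M.Stable τh σ γ := stable_of_excess_eq_zero h0.symm
    have h1 : M.Wst τh σ = M.Khat τh := funext fun γ => by simp [Wst, hall γ]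
    have h2 : M.Wstar τh σ = fun _ => 0 := funext fun γ => by simp [Wstar, hall γ]
    have := excess_nonneg (M := M) τh σ
    rw [h1, h2, pressureOf_zero, gHat]; linarith
  · obtain ⟨L₀, hL₀1, hmin, hL₀⟩ := exists_L0 hd hpos
    -- contours where the weights differ are unstable, hence large
    have hlarge : ∀ γ, ¬ M.Stable τh σ γ → L₀ ≤ #(cs (M.supp γ)) := fun γ hγ =>
      (hmin _ (one_lt_of_not_stable hd1 hγ)).trans (card_le_card (subset_cs _))
    have h1 := abs_pressureOf_sub_le hsK hsW (L₀ := L₀) fun γ _ hne => hlarge γ fun hs => hne (by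
      rw [Wst, if_pos (show M.Stable (τ - 4 ^ (d + 2)) σ γ from hs)])
    have h2 := abs_pressureOf_sub_le hsS hs0 (L₀ := L₀) fun γ _ hne => hlarge γ fun hs => hne (by
      rw [Wstar, if_pos (show M.Stable (τ - 4 ^ (d + 2)) σ γ from hs)])
    rw [pressureOf_zero, sub_zero] at h2
    have hδ : -(2 * (d : ℝ) + 1) * L₀ = -(2 * d + 1) * L₀ := rfl
    rw [show -(2 * (d : ℝ) + 1) * (L₀ : ℝ) = -(2 * d + 1) * L₀ by ring] at h1 h2
    rw [gHat]
    have := (abs_le.1 h1).1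
    have := (abs_le.1 h2).2
    linarith

end KeyEstimate

/-! ### The induction step -/

/-- `G(γ) ≤ ρ(γ) e^{(ψ̂ - log w_σ)|int γ| + 2·3^d|γ̄|}` under the volume bound for the interior components.
[cite: FriedliVelenik2017, §7.4.3 (Π Z^{#'}(int_{#'}γ') ≤ e^{βψ̂_n|int γ'|} e^{3|γ̄'|})] -/
theorem G_le_of_volBound (hd : 2 ≤ d) {τh : ℝ} {N : ℕ} (hVB : M.VolBound τh N) {γ : M.Γ}
    (hints : ∀ A ∈ M.ints γ, #A ≤ N) :
    M.G γ ≤ M.ρ γ * Real.exp ((M.psiMax τh - Real.log (M.w (M.type γ))) * #(M.intr γ) + 2 * (3 ^ d * M.size γ)) := by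
  set σ := M.type γ
  have hw := M.w_pos σ
  calc M.G γ = M.ρ γ * ∏ A ∈ M.ints γ, M.Z (M.lab γ A) A / M.w σ ^ #A := rfl
    _ ≤ M.ρ γ * ∏ A ∈ M.ints γ, Real.exp ((M.psiMax τh - Real.log (M.w σ)) * #A + 2 * #(inBoundary A)) := by
        refine mul_le_mul_of_nonneg_left (prod_le_prod (fun A _ => div_nonneg (M.Z_pos _ _).le (pow_nonneg hw.le _))
          fun A hA => ?_) (M.ρ_nonneg γ)
        rw [div_le_iff₀ (pow_pos hw _), ← Real.exp_log (pow_pos hw _), ← Real.exp_add, Real.log_pow]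
        refine (hVB _ A (starConn_compl_of_mem_ints hd hA) (hints A hA)).trans (Real.exp_le_exp.2 (le_of_eq ?_))
        ring
    _ = M.ρ γ * Real.exp ((M.psiMax τh - Real.log (M.w σ)) * ∑ A ∈ M.ints γ, (#A : ℝ) + 2 * ∑ A ∈ M.ints γ, (#(inBoundary A) : ℝ)) := by
        rw [← Real.exp_sum, sum_add_distrib, mul_sum, mul_sum]
    _ ≤ M.ρ γ * Real.exp ((M.psiMax τh - Real.log (M.w σ)) * #(M.intr γ) + 2 * (3 ^ d * M.size γ)) := by
        refine mul_le_mul_of_nonneg_left (Real.exp_le_exp.2 (add_le_add (le_of_eq ?_) ?_)) (M.ρ_nonneg γ)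
        · rw [← Nat.cast_sum, sum_card_ints_eq hd]
        · refine mul_le_mul_of_nonneg_left ?_ (by norm_num)
          exact_mod_cast sum_card_inBoundary_ints_le hd γ

/-- `Π_A Ξ_*(A) ≥ e^{g_* |int γ| - 3^d |γ̄|}` (lower boundary bound for the unstable gas in the interior
components). [cite: FriedliVelenik2017, §7.4.3 (Ξ^#_*(int γ) ≥ e^{βĝ^#_*|int γ| - |γ̄|})] -/
theorem exp_le_prod_compSum_Wstar (hd : 2 ≤ d) {τh : ℝ} {σ σ' : Phase}
    (hs : IsSmallTIActivity (M.rhoHat σ (M.Wstar τh σ')) (2 * d + 1)) (γ : M.Γ) :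
    Real.exp (M.pressureOf σ (M.Wstar τh σ') * #(M.intr γ) - 3 ^ d * M.size γ) ≤
      ∏ A ∈ M.ints γ, M.compSum σ (M.Wstar τh σ') A := by
  have hd1 : 1 ≤ d := by omega
  calc Real.exp (M.pressureOf σ (M.Wstar τh σ') * #(M.intr γ) - 3 ^ d * M.size γ)
      ≤ Real.exp (∑ A ∈ M.ints γ, (M.pressureOf σ (M.Wstar τh σ') * #A - #(inBoundary A))) := by
        refine Real.exp_le_exp.2 ?_
        rw [sum_sub_distrib, ← mul_sum, ← Nat.cast_sum, sum_card_ints_eq hd, ← Nat.cast_sum]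
        have : ((∑ A ∈ M.ints γ, #(inBoundary A) : ℕ) : ℝ) ≤ 3 ^ d * M.size γ := by exact_mod_cast sum_card_inBoundary_ints_le hd γ
        linarith
    _ = ∏ A ∈ M.ints γ, Real.exp (M.pressureOf σ (M.Wstar τh σ') * #A - #(inBoundary A)) := Real.exp_sum _ _
    _ ≤ ∏ A ∈ M.ints γ, M.compSum σ (M.Wstar τh σ') A := by
        refine prod_le_prod (fun A _ => Real.exp_nonneg _) fun A _ => ?_
        have h := (abs_le.1 (abs_log_compSum_sub_le hs (fun γ => Wstar_nonneg _ _ γ) hd1 le_rfl A)).1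
        rw [← Real.exp_log (compSum_pos (fun γ => Wstar_nonneg _ _ γ) A)]
        exact Real.exp_le_exp.2 (by linarith)

/-- Over the non-`P` families, the sum of `Π f` for a weight vanishing off `P`... [helper]: if `f = 0` on
every `¬P`-contour then only the empty family contributes. [folklore] -/
theorem sum_compFamN_prod_eq_one {P : M.Γ → Prop} [DecidablePred P] {σ : Phase} {W : Finset (Site d)} {f : M.Γ → ℝ}
    (hf : ∀ γ, ¬ P γ → f γ = 0) : ∑ Δ ∈ M.CompFamN P σ W, ∏ δ ∈ Δ, f δ = 1 := by
  rw [← sum_erase_add _ _ (mem_compFamN.2 ⟨empty_mem_compFam σ W, fun δ h => absurd h (notMem_empty δ)⟩), prod_empty]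
  rw [sum_eq_zero fun Δ hΔ => ?_, zero_add]
  obtain ⟨hne, hΔ⟩ := mem_erase.1 hΔ
  obtain ⟨δ, hδ⟩ := nonempty_iff_ne_empty.2 hne
  exact prod_eq_zero hδ (hf δ ((mem_compFamN.1 hΔ).2 δ hδ))

/-- If two weights agree on the non-`P` contours of `W` and one vanishes on the `P`-contours, its
partition function is the sum over the non-`P` families of the other. [folklore] -/
theorem compSum_eq_sum_compFamN {P : M.Γ → Prop} [DecidablePred P] {σ : Phase} {W : Finset (Site d)} {f g : M.Γ → ℝ}
    (hfg : ∀ γ ∈ M.contoursIn σ W, ¬ P γ → f γ = g γ) (hf : ∀ γ, P γ → f γ = 0) :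
    M.compSum σ f W = ∑ Δ ∈ M.CompFamN P σ W, ∏ δ ∈ Δ, g δ := by
  rw [ContourSetup.compSum, CompFamN, sum_filter]
  refine sum_congr rfl fun Δ hΔ => ?_
  split_ifs with hP
  · exact prod_congr rfl fun δ hδ => hfg δ (mem_contoursIn.2 ((mem_compFam.1 hΔ).1 δ hδ)) (hP δ hδ)
  · push Not at hP
    obtain ⟨δ, hδ, hPδ⟩ := hP
    exact prod_eq_zero hδ (hf δ hPδ)

/-- **The induction step** (FV §7.4.3, "Showing that (7.68) holds if |Λ| = n + 1", pointwise form).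
[cite: FriedliVelenik2017, §7.4.3, proof of Prop. 7.34, eqs. (7.86)–(7.89)] -/
theorem volBound_succ (hd : 2 ≤ d) (hrec : M.Rec) (T : M.Shift) {τ : ℝ}
    (hρτ : ∀ γ, M.ρ γ ≤ Real.exp (-τ * M.size γ)) (hρT : ∀ v γ, M.ρ (T.shift v γ) = M.ρ γ)
    (hKT : ∀ v γ, M.K (T.shift v γ) = M.K γ) {Kc : ℕ} (hKc : ∀ A, #(M.withSupp A) ≤ Kc ^ #A)
    (hτ : (Kc : ℝ) * (2 ^ (d + 1) * 9 ^ d) * Real.exp ((2 * d + 2) * 2 ^ d - (τ - 4 ^ (d + 2))) ≤ 1)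
    {N : ℕ} (hVB : M.VolBound (τ - 4 ^ (d + 2)) N) : M.VolBound (τ - 4 ^ (d + 2)) (N + 1) := by
  classical
  set τh := τ - 4 ^ (d + 2) with hτh
  intro σ V hV hN
  have hd1 : 1 ≤ d := by omega
  set a := M.excess τh σ with ha
  set ψ := M.psiMax τh with hψ
  set lw := Real.log (M.w σ) with hlw
  set gst := M.pressureOf σ (M.Wst τh σ) with hgst
  set gstar := M.pressureOf σ (M.Wstar τh σ) with hgstar
  -- smallness of the gases
  have hsW := isSmallTIActivity_Wst T hKT hKc hτ σ σ
  have hsS := isSmallTIActivity_Wstar T hρτ hρT hKc hτ σ σ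
  have hsK := isSmallTIActivity_Khat T hKT hKc hτ σ
  -- basic inequalities between the pressures
  have hkey : gst + gstar ≤ a + M.gHat τh σ := pressure_key hd T hρτ hρT hKT hKc hτ σ
  have hgstar0 : 0 ≤ gstar := pressureOf_nonneg hsS (fun γ => Wstar_nonneg _ _ γ) hd1
  have hgstar1 : gstar ≤ 1 := le_trans (le_abs_self _) ((abs_pressureOf_le hsS).trans (by
    rw [Real.exp_le_one_iff]; have : (0 : ℝ) ≤ d := Nat.cast_nonneg d; linarith))
  have hgK0 : 0 ≤ M.gHat τh σ := pressureOf_nonneg hsK (fun γ => Khat_nonneg _ γ) hd1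
  have ha0 : 0 ≤ a := excess_nonneg τh σ
  have hψlw : a + M.gHat τh σ = ψ - lw := by rw [ha, excess, psiHat]; ring
  -- contours of `V` have interior components of size `≤ N`
  have hintsV : ∀ γ ∈ M.contoursIn σ V, ∀ A ∈ M.ints γ, #A ≤ N := fun γ hγ A hA =>
    Nat.lt_succ_iff.1 (lt_of_lt_of_le (card_lt_of_mem_ints_of_inVol hd hV (mem_contoursIn.1 hγ).2 hA) hN)
  -- stable contours in `V` have `K = K̂`
  have hKeq : ∀ γ ∈ M.contoursIn σ V, M.Stable τh σ γ → M.K γ = M.Khat τh γ := by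
    intro γ hγ hst
    have ht : M.type γ = σ := (mem_contoursIn.1 hγ).1
    exact (min_eq_left (K_le_exp_of_stable hd hrec T hρτ hKT hKc hτ hVB (ht ▸ hst) (hintsV γ hγ))).symm
  -- (EQ1): fix the external unstable contours
  set U : M.Γ → Prop := fun γ => ¬ M.Stable τh σ γ with hU
  have hEQ : M.Z σ V = M.w σ ^ #V * ∑ Γ ∈ M.ExtFamP U σ V,
      M.compSum σ (M.Wst τh σ) (M.Wvol V Γ) * ∏ γ ∈ Γ, M.G γ := by
    rw [Z_eq_mul_compSum hd hrec σ hV, ContourSetup.compSum, sum_compFam_eq_sum_extFamP hd hV U σ M.K]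
    congr 1
    refine sum_congr rfl fun Γ hΓ => ?_
    obtain ⟨hΓe, hΓU⟩ := mem_extFamP.1 hΓ
    have hΓ1 := (mem_compFam.1 (mem_extFam.1 hΓe).1).1
    -- the stable gas of the exterior
    have hW : ∑ Δ ∈ M.CompFamN U σ (M.Wvol V Γ), ∏ δ ∈ Δ, M.K δ = M.compSum σ (M.Wst τh σ) (M.Wvol V Γ) := by
      symm
      refine compSum_eq_sum_compFamN (fun γ hγ hnU => ?_) (fun γ hUγ => by simp [Wst, hU ▸ hUγ])
      have hst : M.Stable τh σ γ := by rwa [hU, not_not] at hnU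
      have hγV : γ ∈ M.contoursIn σ V := by
        obtain ⟨ht, hW⟩ := mem_contoursIn.1 hγ
        exact mem_contoursIn.2 ⟨ht, fun z hz => (mem_Wvol.1 (hW hz)).1⟩
      simp [Wst, hst, hKeq γ hγV hst]
    rw [hW, mul_left_comm, ← prod_mul_distrib]
    congr 1
    refine prod_congr rfl fun γ hγ => ?_
    rw [G_eq_K_mul, (hΓ1 γ hγ).1]
    congr 1
    refine prod_congr rfl fun A hA => ?_
    rw [← ContourSetup.compSum, ← Z_div_eq_compSum hd hrec _ σ A (starConn_compl_of_mem_ints hd hA) le_rfl]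
  -- the per-family bound
  have hterm : ∀ Γ ∈ M.ExtFamP U σ V, M.w σ ^ #V * (M.compSum σ (M.Wst τh σ) (M.Wvol V Γ) * ∏ γ ∈ Γ, M.G γ) ≤
      Real.exp (ψ * #V + #(inBoundary V) - gstar * #V) *
        ∏ γ ∈ Γ, (M.Wstar τh σ γ * ∏ A ∈ M.ints γ, M.compSum σ (M.Wstar τh σ) A) := by
    intro Γ hΓ
    obtain ⟨hΓe, hΓU⟩ := mem_extFamP.1 hΓ
    have hΓ1 := (mem_compFam.1 (mem_extFam.1 hΓe).1).1
    set W := M.Wvol V Γ with hWdef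
    -- the pieces
    have hcs : M.compSum σ (M.Wst τh σ) W ≤ Real.exp (gst * #W + #(inBoundary W)) := by
      have h := (abs_le.1 (abs_log_compSum_sub_le hsW (fun γ => (Wst_nonneg_le _ _ γ).1) hd1 le_rfl W)).2
      rw [← Real.exp_log (compSum_pos (fun γ => (Wst_nonneg_le _ _ γ).1) W)]
      exact Real.exp_le_exp.2 (by linarith)
    have hbdW : (#(inBoundary W) : ℝ) ≤ #(inBoundary V) + 3 ^ d * ∑ γ ∈ Γ, (M.size γ : ℝ) := by
      exact_mod_cast card_inBoundary_Wvol_le hd V Γ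
    have hcardV : (#V : ℝ) = #W + ∑ γ ∈ Γ, ((M.size γ : ℝ) + #(M.intr γ)) := by
      exact_mod_cast card_eq_card_Wvol_add hd hV hΓe
    have hG : ∀ γ ∈ Γ, M.G γ ≤ M.ρ γ * Real.exp ((ψ - lw) * #(M.intr γ) + 2 * (3 ^ d * M.size γ)) := fun γ hγ => by
      have := G_le_of_volBound hd hVB (hintsV γ (mem_contoursIn.2 (hΓ1 γ hγ)))
      rwa [(hΓ1 γ hγ).1] at this
    have hS : ∀ γ ∈ Γ, M.ρ γ * Real.exp ((3 ^ (d + 1) + 1 + 3 ^ d) * M.size γ) *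
        Real.exp (gstar * #(M.intr γ) - 3 ^ d * M.size γ) ≤
          M.Wstar τh σ γ * ∏ A ∈ M.ints γ, M.compSum σ (M.Wstar τh σ) A := fun γ hγ => by
      have hu : ¬ M.Stable τh σ γ := hΓU γ hγ
      rw [Wstar, if_neg hu]
      exact mul_le_mul_of_nonneg_left (exp_le_prod_compSum_Wstar hd hsS γ) (mul_nonneg (M.ρ_nonneg γ) (Real.exp_nonneg _))
    -- assemble: left side ≤ exp(E1) Π ρ, right side ≥ exp(E2) Π ρ, and E1 ≤ E2
    have hw : M.w σ ^ #V = Real.exp (lw * #V) := by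
      rw [hlw, mul_comm, ← Real.log_pow, Real.exp_log (pow_pos (M.w_pos σ) _)]
    calc M.w σ ^ #V * (M.compSum σ (M.Wst τh σ) W * ∏ γ ∈ Γ, M.G γ)
        ≤ Real.exp (lw * #V) * (Real.exp (gst * #W + #(inBoundary W)) *
            ∏ γ ∈ Γ, (M.ρ γ * Real.exp ((ψ - lw) * #(M.intr γ) + 2 * (3 ^ d * M.size γ)))) := by
          rw [hw]
          refine mul_le_mul_of_nonneg_left (mul_le_mul hcs (prod_le_prod (fun γ _ => G_nonneg γ) hG)
            (prod_nonneg fun γ _ => G_nonneg γ) (Real.exp_nonneg _)) (Real.exp_nonneg _)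
      _ = Real.exp (lw * #V + gst * #W + #(inBoundary W) + ∑ γ ∈ Γ, ((ψ - lw) * #(M.intr γ) + 2 * (3 ^ d * M.size γ))) *
            ∏ γ ∈ Γ, M.ρ γ := by
          rw [prod_mul_distrib, ← Real.exp_sum]; simp only [Real.exp_add]; ring
      _ ≤ Real.exp (ψ * #V + #(inBoundary V) - gstar * #V +
            ∑ γ ∈ Γ, ((3 ^ (d + 1) + 1 + 3 ^ d) * M.size γ + (gstar * #(M.intr γ) - 3 ^ d * M.size γ))) * ∏ γ ∈ Γ, M.ρ γ := by
          refine mul_le_mul_of_nonneg_right (Real.exp_le_exp.2 ?_) (prod_nonneg fun γ _ => M.ρ_nonneg γ)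
          -- the exponent inequality `E1 ≤ E2`
          have hb : 0 ≤ ψ - lw - gst - gstar := by linarith
          have hc : 0 ≤ ψ - lw - gstar + 1 := by linarith
          have hsum1 : ∑ γ ∈ Γ, ((ψ - lw) * #(M.intr γ) + 2 * (3 ^ d * (M.size γ : ℝ))) =
              (ψ - lw) * ∑ γ ∈ Γ, (#(M.intr γ) : ℝ) + 2 * 3 ^ d * ∑ γ ∈ Γ, (M.size γ : ℝ) := by
            rw [sum_add_distrib, mul_sum, mul_sum]; congr 1; exact sum_congr rfl fun _ _ => by ring
          have hsum2 : ∑ γ ∈ Γ, ((3 ^ (d + 1) + 1 + 3 ^ d) * (M.size γ : ℝ) + (gstar * #(M.intr γ) - 3 ^ d * M.size γ)) =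
              (3 ^ (d + 1) + 1) * ∑ γ ∈ Γ, (M.size γ : ℝ) + gstar * ∑ γ ∈ Γ, (#(M.intr γ) : ℝ) := by
            rw [mul_sum, mul_sum, ← sum_add_distrib]; exact sum_congr rfl fun _ _ => by ring
          have hcardV' : (#V : ℝ) = #W + ∑ γ ∈ Γ, (M.size γ : ℝ) + ∑ γ ∈ Γ, (#(M.intr γ) : ℝ) := by
            rw [hcardV, sum_add_distrib]; ring
          rw [hsum1, hsum2, hcardV']
          have hn0 : 0 ≤ ∑ γ ∈ Γ, (M.size γ : ℝ) := sum_nonneg fun _ _ => Nat.cast_nonneg _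
          have hW0 : (0 : ℝ) ≤ #W := Nat.cast_nonneg _
          have h3 : (3 : ℝ) ^ (d + 1) = 3 * 3 ^ d := by ring
          nlinarith [mul_nonneg hb hW0, mul_nonneg hc hn0]
      _ = Real.exp (ψ * #V + #(inBoundary V) - gstar * #V) *
            ∏ γ ∈ Γ, (M.ρ γ * Real.exp ((3 ^ (d + 1) + 1 + 3 ^ d) * M.size γ) *
              Real.exp (gstar * #(M.intr γ) - 3 ^ d * M.size γ)) := by
          rw [sum_add_distrib, prod_mul_distrib, prod_mul_distrib, ← Real.exp_sum, ← Real.exp_sum]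
          simp only [Real.exp_add]; ring
      _ ≤ Real.exp (ψ * #V + #(inBoundary V) - gstar * #V) *
            ∏ γ ∈ Γ, (M.Wstar τh σ γ * ∏ A ∈ M.ints γ, M.compSum σ (M.Wstar τh σ) A) :=
          mul_le_mul_of_nonneg_left (prod_le_prod (fun γ _ => mul_nonneg (mul_nonneg (M.ρ_nonneg γ) (Real.exp_nonneg _))
            (Real.exp_nonneg _)) hS) (Real.exp_nonneg _)
  -- resum the unstable contours
  have hresum : ∑ Γ ∈ M.ExtFamP U σ V, ∏ γ ∈ Γ, (M.Wstar τh σ γ * ∏ A ∈ M.ints γ, M.compSum σ (M.Wstar τh σ) A) =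
      M.compSum σ (M.Wstar τh σ) V := by
    rw [ContourSetup.compSum, sum_compFam_eq_sum_extFamP hd hV U σ (M.Wstar τh σ)]
    refine sum_congr rfl fun Γ _ => ?_
    rw [sum_compFamN_prod_eq_one fun γ hγ => by simp [Wstar, (show M.Stable τh σ γ by rwa [hU, not_not] at hγ)],
      one_mul, prod_mul_distrib]
    rfl
  have hstar : M.compSum σ (M.Wstar τh σ) V ≤ Real.exp (gstar * #V + #(inBoundary V)) := by
    have h := (abs_le.1 (abs_log_compSum_sub_le hsS (fun γ => Wstar_nonneg _ _ γ) hd1 le_rfl V)).2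
    rw [← Real.exp_log (compSum_pos (fun γ => Wstar_nonneg _ _ γ) V)]
    exact Real.exp_le_exp.2 (by linarith)
  -- conclusion
  calc M.Z σ V = ∑ Γ ∈ M.ExtFamP U σ V, M.w σ ^ #V * (M.compSum σ (M.Wst τh σ) (M.Wvol V Γ) * ∏ γ ∈ Γ, M.G γ) := by
        rw [hEQ, mul_sum]
    _ ≤ ∑ Γ ∈ M.ExtFamP U σ V, Real.exp (ψ * #V + #(inBoundary V) - gstar * #V) *
          ∏ γ ∈ Γ, (M.Wstar τh σ γ * ∏ A ∈ M.ints γ, M.compSum σ (M.Wstar τh σ) A) := sum_le_sum hterm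
    _ = Real.exp (ψ * #V + #(inBoundary V) - gstar * #V) * M.compSum σ (M.Wstar τh σ) V := by rw [← mul_sum, hresum]
    _ ≤ Real.exp (ψ * #V + #(inBoundary V) - gstar * #V) * Real.exp (gstar * #V + #(inBoundary V)) :=
        mul_le_mul_of_nonneg_left hstar (Real.exp_nonneg _)
    _ = Real.exp (ψ * #V + 2 * #(inBoundary V)) := by rw [← Real.exp_add]; ring_nf

/-! ### The main theorems -/

/-- **The volume bound holds for all volumes** (FV Prop. 7.34 (2), eq. (7.68), pointwise form).
[cite: FriedliVelenik2017, §7.4.3, Prop. 7.34, eq. (7.68)] -/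
theorem volBound (hd : 2 ≤ d) (hrec : M.Rec) (T : M.Shift) {τ : ℝ}
    (hρτ : ∀ γ, M.ρ γ ≤ Real.exp (-τ * M.size γ)) (hρT : ∀ v γ, M.ρ (T.shift v γ) = M.ρ γ)
    (hKT : ∀ v γ, M.K (T.shift v γ) = M.K γ) {Kc : ℕ} (hKc : ∀ A, #(M.withSupp A) ≤ Kc ^ #A)
    (hτ : (Kc : ℝ) * (2 ^ (d + 1) * 9 ^ d) * Real.exp ((2 * d + 2) * 2 ^ d - (τ - 4 ^ (d + 2))) ≤ 1) :
    ∀ N, M.VolBound (τ - 4 ^ (d + 2)) N := by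
  intro N
  induction N with
  | zero =>
    intro σ V hV hN
    have hV0 : V = ∅ := card_eq_zero.1 (Nat.le_zero.1 hN)
    subst hV0
    rw [hrec.eq σ ∅ hV]
    have h1 : M.ExtFam σ ∅ = {∅} := by
      refine eq_singleton_iff_unique_mem.2 ⟨empty_mem_extFam σ ∅, fun Γ hΓ => eq_empty_of_forall_notMem fun γ hγ => ?_⟩
      obtain ⟨x, hx⟩ := M.supp_nonempty γ
      exact notMem_empty x (supp_subset_of_inVol ((mem_compFam.1 (mem_extFam.1 hΓ).1).1 γ hγ).2 hx)
    simp [h1]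
  | succ N ih => exact volBound_succ hd hrec T hρτ hρT hKT hKc hτ ih

/-- **In a phase with zero excess, every contour of that type obeys the Peierls-type bound
`K_σ(γ) ≤ e^{-τ̂|γ̄|}`**, `τ̂ = τ - 4^{d+2}` (FV Prop. 7.34 (1) with (7.66): `aⁿ_# = 0` makes all
contours stable, and stable contours have `ŵ = w ≤ e^{-τ|γ̄|}`). Together with `exists_excess_eq_zero`
this is the dichotomy at the heart of the first-order transition.
[cite: FriedliVelenik2017, §7.4.3, Prop. 7.34, eqs. (7.65)–(7.66)] -/
theorem K_le_exp_of_excess_eq_zero (hd : 2 ≤ d) (hrec : M.Rec) (T : M.Shift) {τ : ℝ}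
    (hρτ : ∀ γ, M.ρ γ ≤ Real.exp (-τ * M.size γ)) (hρT : ∀ v γ, M.ρ (T.shift v γ) = M.ρ γ)
    (hKT : ∀ v γ, M.K (T.shift v γ) = M.K γ) {Kc : ℕ} (hKc : ∀ A, #(M.withSupp A) ≤ Kc ^ #A)
    (hτ : (Kc : ℝ) * (2 ^ (d + 1) * 9 ^ d) * Real.exp ((2 * d + 2) * 2 ^ d - (τ - 4 ^ (d + 2))) ≤ 1)
    {σ : Phase} (hσ : M.excess (τ - 4 ^ (d + 2)) σ = 0) {γ : M.Γ} (hγ : M.type γ = σ) :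
    M.K γ ≤ Real.exp (-(τ - 4 ^ (d + 2)) * M.size γ) :=
  K_le_exp_of_stable hd hrec T hρτ hKT hKc hτ (volBound hd hrec T hρτ hρT hKT hKc hτ _)
    (hγ ▸ stable_of_excess_eq_zero hσ γ) fun _ hA => (card_le_card ((subset_intr_of_mem_ints hA).trans (intr_subset_hull γ)))

/-- **The dominant ground state is stable**: if `log w_σ ≥ log w_{σ'} + 2 e^{-(2d+1)}` for the other
phase `σ'`, then `a_σ = 0` (the truncated pressures satisfy `|ĝ| ≤ e^{-(2d+1)}`).
[cite: FriedliVelenik2017, §7.4.1 (𝒰^#: ψ̂^#' - ψ̂^# ≤ 0) with Thm. 7.29 (|g| ≤ η)] -/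
theorem excess_eq_zero_of_log_le (T : M.Shift) {τ : ℝ} (hKT : ∀ v γ, M.K (T.shift v γ) = M.K γ) {Kc : ℕ}
    (hKc : ∀ A, #(M.withSupp A) ≤ Kc ^ #A)
    (hτ : (Kc : ℝ) * (2 ^ (d + 1) * 9 ^ d) * Real.exp ((2 * d + 2) * 2 ^ d - (τ - 4 ^ (d + 2))) ≤ 1)
    {σ : Phase} (hw : Real.log (M.w σ.other) + 2 * Real.exp (-(2 * d + 1)) ≤ Real.log (M.w σ)) :
    M.excess (τ - 4 ^ (d + 2)) σ = 0 := by
  set τh := τ - 4 ^ (d + 2)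
  have hb : ∀ σ', |M.gHat τh σ'| ≤ Real.exp (-(2 * d + 1)) := fun σ' =>
    abs_pressureOf_le (isSmallTIActivity_Khat T hKT hKc hτ σ')
  have h1 := (abs_le.1 (hb σ)).1
  have h2 := (abs_le.1 (hb σ.other)).2
  have hle : M.psiHat τh σ.other ≤ M.psiHat τh σ := by rw [psiHat, psiHat]; linarith
  have hmax : M.psiMax τh = M.psiHat τh σ := by
    cases σ
    · exact max_eq_left hle
    · exact max_eq_right hle
  rw [excess, hmax, sub_self]

/-- **The external families through a given contour** (FV Lemma 7.26, partition-function form): for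
`γ₀` of type `σ` in `V`, `w_σ^{|V|} Σ_{Γ external family in V, γ₀ ∈ Γ} Π_Γ G ≤ K(γ₀) Z_σ(V)`.
[cite: FriedliVelenik2017, §7.3.2, Lemma 7.26, eq. (7.36)] -/
theorem extFam_through_le (hd : 2 ≤ d) (hrec : M.Rec) {σ : Phase} {V : Finset (Site d)}
    (hV : StarConn (V : Set (Site d))ᶜ) {γ₀ : M.Γ} (h₀ : γ₀ ∈ M.contoursIn σ V) :
    M.w σ ^ #V * ∑ Γ ∈ (M.ExtFam σ V).filter (fun Γ => γ₀ ∈ Γ), ∏ γ ∈ Γ, M.G γ ≤ M.K γ₀ * M.Z σ V := by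
  have ht : M.type γ₀ = σ := (mem_contoursIn.1 h₀).1
  rw [sum_extFam_filter_mem_eq, G_eq_K_mul, ht]
  have hZA : ∀ A ∈ M.ints γ₀, M.Z σ A / M.w σ ^ #A = ∑ Γ ∈ M.ExtFam σ A, ∏ γ ∈ Γ, M.G γ := fun A hA => by
    rw [hrec.eq σ A (starConn_compl_of_mem_ints hd hA), mul_div_cancel_left₀ _ (pow_ne_zero _ (M.w_pos σ).ne')]
  rw [prod_congr rfl hZA, hrec.eq σ V hV]
  have hw : 0 ≤ M.w σ ^ #V := pow_nonneg (M.w_pos σ).le _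
  calc M.w σ ^ #V * (M.K γ₀ * (∏ A ∈ M.ints γ₀, ∑ Γ ∈ M.ExtFam σ A, ∏ γ ∈ Γ, M.G γ) *
        ∑ Γ ∈ (M.ExtFam σ V).filter (fun Γ => γ₀ ∉ Γ ∧ insert γ₀ Γ ∈ M.ExtFam σ V), ∏ γ ∈ Γ, M.G γ)
      = M.K γ₀ * (M.w σ ^ #V * ((∑ Γ ∈ (M.ExtFam σ V).filter (fun Γ => γ₀ ∉ Γ ∧ insert γ₀ Γ ∈ M.ExtFam σ V),
          ∏ γ ∈ Γ, M.G γ) * ∏ A ∈ M.ints γ₀, ∑ Γ ∈ M.ExtFam σ A, ∏ γ ∈ Γ, M.G γ)) := by ring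
    _ ≤ M.K γ₀ * (M.w σ ^ #V * ∑ Γ ∈ M.ExtFam σ V, ∏ γ ∈ Γ, M.G γ) :=
        mul_le_mul_of_nonneg_left (mul_le_mul_of_nonneg_left (sum_extFam_avoid_mul_prod_le hd hV h₀ M.G G_nonneg) hw)
          (K_nonneg γ₀)

end ContourModel

end Literature.Probability.LatticeModels

end
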